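import Summits.ValiantsHypothesis.ValiantsHypothesis.Theorems.BarrierLeverSuccinctHittingSetsForVPPolyParametrization
import Literature.Barriers.ValiantsHypothesis.AlgebraicNaturalProofsGenerators
import Literature.Computability.AlgebraicComplexity.KRSTDesign
import Literature.Computability.AlgebraicComplexity.StandardFamilies
import Literature.Computability.MetaComplexity.NWGenerator
import Mathlib

/-!
# Crux `BarrierLever.SuccinctHittingSetsForVP` (stmt-ValiantsHypothesis-14610) — THE DIMENSION EDGE,
# part 1: ideal succinctness, low-support equations of `SmallCircuits ℂ n b`, and the transversal lemma

Lean text authored by the cell planner seat `valiant-natproofs-p2` (gen 2 / 2b, HOME/Sketch-p2g2.lean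
§1 and HOME/Sketch-p2g2b.lean §1–§2), landed by the prover seat as a helper of the crux, with the
planner's mirrors of the door file (`AlgebraicNaturalProofsGenerators.lean`) and of `KRSTDesign.lean`
replaced by the imports. Unconditional; does NOT close the item (cell `valiant-natproofs`, V4,
D-0053: the `VP` barrier is conditional on a succinct-generator conjecture; this pair of files shows
where KRST's own generator cannot supply it). Part 2 (`…KRSTEdge.lean`) applies this to KRST's
generator.

* `IsIdealSuccinctGenerator` — the weakest succinctness: every equation of `coeff(𝒞)` annihilates
  the generator; per-seed succinct ⇒ ideal over an infinite field (`IsSuccinctGenerator.ideal`).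
* `exists_equation_on`, `exists_equation_supported` — LOW-SUPPORT EQUATIONS: any family of
  coordinates `E : ι → degLEMonomials n` with `2^|ι| > (|ι|·2n+1)^(9376 (n+4)^(5b+21))` carries a
  nonzero equation of `coeff(SmallCircuits ℂ n b)` in those coordinates only, of degree `≤ |ι|`
  (Raz parametrisation `exists_parametrization` + counting
  `LowDegreeEquations.exists_ne_zero_aeval_eq_zero`); `threshold` — the arithmetic for
  `|ι| = (n+4)^(5b+23)`.
* `bind₁_rename_ne_zero_of_transversal`, `not_idealSuccinct_of_transversal` — TRANSVERSAL LEMMA: if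
  one substitution of the seed variables turns the outputs `G (E i)` into distinct variables, no
  nonzero polynomial in those coordinates annihilates `G`; `two_pow_le_of_transversal` — hence an
  ideal-succinct generator for `SmallCircuits ℂ n b` has no large transversal.

WHAT THIS IS NOT: not a lower bound (dimension count); Raz's constants, not the true dimension.

References: [ForbesShpilkaVolk2018] Def. 7 (succinct generators); [KumarRamyaSaptharishiTengse2022]
§3.3–3.4; [Raz2010] (the parametrisation behind `exists_parametrization`).
-/

-- layout Summits/ValiantsHypothesis/ValiantsHypothesis forces the duplicated namespace component
set_option linter.dupNamespace false

noncomputable section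

namespace Summit.ValiantsHypothesis.ValiantsHypothesis.Theorems.BarrierLever.SuccinctHittingSetsForVP

namespace KRSTEdge

open Literature.Barriers.ValiantsHypothesis Literature.Computability.AlgebraicComplexity
  Literature.Computability.MetaComplexity MvPolynomial
open Summit.ValiantsHypothesis.ValiantsHypothesis.Theorems.BarrierLever.SuccinctHittingSetsForVP

/-! ### 0. Ideal succinctness (planner p2, gen 2, `Sketch-p2g2.lean` §1) -/

section Ideal

variable {F : Type*} [CommSemiring F] {σ τ : Type*}

/-- **Ideal succinctness** — the weakest succinctness of a generator `G` for a class `𝒞`: every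
equation of `coeff_M(𝒞)` annihilates `G` (equivalently, the image of `G` lies in the Zariski
closure of `coeff_M(𝒞)`). Per-seed succinctness (FSV Def. 7(2), `IsSuccinctGenerator`) implies it
over an infinite field. [cite: ForbesShpilkaVolk2018, Def. 7] -/
def IsIdealSuccinctGenerator (M : Set (σ →₀ ℕ)) (𝒞 : Set (MvPolynomial σ F))
    (G : M → MvPolynomial τ F) : Prop :=
  ∀ D : MvPolynomial M F, (∀ f ∈ 𝒞, eval (coeffVector M f) D = 0) → bind₁ G D = 0

end Ideal

section IdealOfSucc

variable {F : Type*} [Field F] [Infinite F] {σ τ : Type*} {M : Set (σ →₀ ℕ)}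

/-- Per-seed succinctness implies ideal succinctness over an infinite field (planner p2, gen 2).
[cite: ForbesShpilkaVolk2018, Def. 7] -/
theorem IsSuccinctGenerator.ideal {𝒞 : Set (MvPolynomial σ F)} {G : M → MvPolynomial τ F}
    (hsucc : IsSuccinctGenerator M 𝒞 G) : IsIdealSuccinctGenerator M 𝒞 G := by
  intro D hvan
  refine MvPolynomial.funext fun a => ?_
  obtain ⟨f, hf, hfa⟩ := hsucc a
  rw [eval_bind₁_eq_eval_genOutput, ← hfa, hvan f hf, map_zero]

end IdealOfSucc

/-- **KRST's generator** (the KI generator over the Reed–Solomon design with base polynomial `Perm_[p]`,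
KRST 2022 §3.4), in the door's shape: output `μ ↦ Perm_[p](y ∘ S_μ)`. Its per-seed succinctness for `𝒞 n`
is literally the prover's `KRSTSuccinctIn 𝒞 c n` (see `krst_not_succinctIn`). -/
def krstGen (F : Type*) [CommSemiring F] (p n : ℕ) [Fact p.Prime] {m : ℕ} (hmp : m * m ≤ p) :
    degLEMonomials n → MvPolynomial (ZMod p × ZMod p) F :=
  designGenerator (perPad F hmp) fun μ => ⇑(krstDesign p n μ)

/-! ### 1. Low-support equations of `SmallCircuits ℂ n b` -/

section LowSupport

/-- **Low-support equations.** Any `|ι|` coordinates `E i ∈ degLEMonomials n` with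
`2^|ι| > (|ι|·2n+1)^(9376 (n+4)^(5b+21))` carry a nonzero equation of `coeff(SmallCircuits ℂ n b)` of degree
`≤ |ι|` (in the variables `ι`; `E` need not be injective). -/
theorem exists_equation_on (b n : ℕ) (hn : 1 ≤ n) {ι : Type*} [Fintype ι]
    (E : ι → degLEMonomials n)
    (hcard : (Fintype.card ι * (2 * n) + 1) ^ (9376 * (n + 4) ^ (5 * b + 21)) < 2 ^ Fintype.card ι) :
    ∃ D₀ : MvPolynomial ι ℂ, D₀ ≠ 0 ∧ D₀.totalDegree ≤ Fintype.card ι ∧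
      ∀ f ∈ SmallCircuits ℂ n b,
        eval (fun i => coeff ((E i : degLEMonomials n) : Fin n →₀ ℕ) f) D₀ = 0 := by
  classical
  obtain ⟨p, G, hp, hdeg, hG⟩ := exists_parametrization b n hn
  have hcard' : (Fintype.card ι * (2 * n) + 1) ^ Fintype.card (Fin p) < 2 ^ Fintype.card ι := by
    rw [Fintype.card_fin]
    exact lt_of_le_of_lt (Nat.pow_le_pow_right (Nat.succ_pos _) hp) hcard
  obtain ⟨D₀, hD0, hdegD, hann⟩ :=
    LowDegreeEquations.exists_ne_zero_aeval_eq_zero (G ∘ E) (fun i => hdeg (E i)) hcard'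
  refine ⟨D₀, hD0, hdegD, fun f hf => ?_⟩
  obtain ⟨y, hy⟩ := hG f hf
  have hpt : (fun i => coeff ((E i : degLEMonomials n) : Fin n →₀ ℕ) f) =
      fun i => eval y ((G ∘ E) i) := by
    funext i; rw [Function.comp_apply, hy]
  rw [hpt, ← LowDegreeEquations.eval_comp_aeval y (G ∘ E) D₀, hann, map_zero]

/-- The same equation as a polynomial in ALL coordinates, supported on `range E`. -/
theorem exists_equation_supported (b n : ℕ) (hn : 1 ≤ n) {ι : Type*} [Fintype ι]
    (E : ι ↪ degLEMonomials n)
    (hcard : (Fintype.card ι * (2 * n) + 1) ^ (9376 * (n + 4) ^ (5 * b + 21)) < 2 ^ Fintype.card ι) :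
    ∃ D : MvPolynomial (degLEMonomials n) ℂ, D ≠ 0 ∧ D.totalDegree ≤ Fintype.card ι ∧
      (∀ m ∈ D.vars, m ∈ Set.range E) ∧
      ∀ f ∈ SmallCircuits ℂ n b, eval (coeffVector (degLEMonomials n) f) D = 0 := by
  classical
  obtain ⟨D₀, hD0, hdeg, hvan⟩ := exists_equation_on b n hn E hcard
  refine ⟨rename E D₀, fun h => hD0 (rename_injective _ E.injective (by rw [h, map_zero])),
    (totalDegree_rename_le _ _).trans hdeg, fun m hm => ?_, fun f hf => ?_⟩
  · obtain ⟨i, -, rfl⟩ := Finset.mem_image.mp (vars_rename E D₀ hm)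
    exact ⟨i, rfl⟩
  · rw [eval_rename]
    exact hvan f hf

/-- Arithmetic: `(k·2n+1)^(9376 (n+4)^(5b+21)) < 2^k` for `k = (n+4)^(5b+23)` and all large `n`. -/
theorem threshold (b : ℕ) : ∃ n₀ : ℕ, ∀ n : ℕ, n₀ ≤ n →
    ((n + 4) ^ (5 * b + 23) * (2 * n) + 1) ^ (9376 * (n + 4) ^ (5 * b + 21)) <
      2 ^ ((n + 4) ^ (5 * b + 23)) := by
  obtain ⟨m₀, hm₀⟩ := LowDegreeEquations.eventually_mul_pow_le_two_pow 1 (9376 * (5 * b + 25))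
  refine ⟨m₀, fun n hn => ?_⟩
  have hm3 : 3 ≤ n + 4 := by omega
  have hpow : 1 ≤ (n + 4) ^ (5 * b + 24) := Nat.one_le_pow _ _ (by omega)
  have h1 : (n + 4) ^ (5 * b + 23) * (2 * n) + 1 ≤ (n + 4) ^ (5 * b + 25) := by
    have hn' : 2 * n ≤ 2 * (n + 4) := by omega
    calc (n + 4) ^ (5 * b + 23) * (2 * n) + 1
        ≤ (n + 4) ^ (5 * b + 23) * (2 * (n + 4)) + (n + 4) ^ (5 * b + 24) :=
          Nat.add_le_add (Nat.mul_le_mul_left _ hn') hpow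
      _ = 3 * (n + 4) ^ (5 * b + 24) := by ring
      _ ≤ (n + 4) * (n + 4) ^ (5 * b + 24) := Nat.mul_le_mul_right _ hm3
      _ = (n + 4) ^ (5 * b + 25) := by ring
  have h2 : (n + 4) ^ (9376 * (5 * b + 25)) < 2 ^ ((n + 4) ^ 2) := by
    have hA := hm₀ (n + 4) (by omega)
    rw [one_mul] at hA
    calc (n + 4) ^ (9376 * (5 * b + 25)) ≤ 2 ^ (n + 4) := hA
      _ < 2 ^ ((n + 4) ^ 2) := Nat.pow_lt_pow_right (by norm_num) (by nlinarith [hm3])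
  have hne : (n + 4) ^ (5 * b + 21) ≠ 0 := (pow_pos (by omega : 0 < n + 4) _).ne'
  calc ((n + 4) ^ (5 * b + 23) * (2 * n) + 1) ^ (9376 * (n + 4) ^ (5 * b + 21))
      ≤ ((n + 4) ^ (5 * b + 25)) ^ (9376 * (n + 4) ^ (5 * b + 21)) := Nat.pow_le_pow_left h1 _
    _ = ((n + 4) ^ (9376 * (5 * b + 25))) ^ ((n + 4) ^ (5 * b + 21)) := by
        rw [← pow_mul, ← pow_mul, show (5 * b + 25) * (9376 * (n + 4) ^ (5 * b + 21)) =
          9376 * (5 * b + 25) * (n + 4) ^ (5 * b + 21) by ring]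
    _ < (2 ^ ((n + 4) ^ 2)) ^ ((n + 4) ^ (5 * b + 21)) := Nat.pow_lt_pow_left h2 hne
    _ = 2 ^ ((n + 4) ^ (5 * b + 23)) := by
        rw [← pow_mul, show (n + 4) ^ 2 * (n + 4) ^ (5 * b + 21) = (n + 4) ^ (5 * b + 23) by ring]

end LowSupport

/-! ### 2. The transversal lemma -/

section Transversal

variable {F : Type*} [CommSemiring F] {σ τ κ ι : Type*} {M : Set (σ →₀ ℕ)}

/-- `bind₁ (X ∘ ν) = rename ν`. -/
theorem bind₁_X_comp (ν : ι → κ) (D : MvPolynomial ι F) :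
    bind₁ (fun i => (X (ν i) : MvPolynomial κ F)) D = rename ν D := by
  have : bind₁ (fun i => (X (ν i) : MvPolynomial κ F)) = rename ν := by
    apply algHom_ext; intro i; rw [bind₁_X_right, rename_X]
  exact congrArg (fun φ : MvPolynomial ι F →ₐ[F] MvPolynomial κ F => φ D) this

/-- **Transversal lemma.** If a substitution `H` of the seed variables sends the outputs `G (E i)` to
pairwise distinct variables `X (ν i)`, then no nonzero polynomial in the coordinates `E i` annihilates `G`.
(Neither injectivity of `E` nor any design property is assumed; they follow.) -/
theorem bind₁_rename_ne_zero_of_transversal {G : M → MvPolynomial τ F} {E : ι → M}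
    {H : τ → MvPolynomial κ F} {ν : ι → κ} (hH : ∀ i, bind₁ H (G (E i)) = X (ν i))
    (hν : Function.Injective ν) {D₀ : MvPolynomial ι F} (hD₀ : D₀ ≠ 0) :
    bind₁ G (rename E D₀) ≠ 0 := by
  intro h0
  have h1 : bind₁ H (bind₁ G (rename E D₀)) = rename ν D₀ := by
    rw [bind₁_bind₁, bind₁_rename]
    have : ((fun m => bind₁ H (G m)) ∘ E) = fun i => (X (ν i) : MvPolynomial κ F) := by
      funext i; exact hH i
    rw [this, bind₁_X_comp]
  rw [h0, map_zero] at h1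
  exact hD₀ (rename_injective ν hν (by rw [map_zero]; exact h1.symm))

/-- Hence: a transversal on coordinates `E i` plus an equation of `coeff(𝒞)` in those coordinates refutes
ideal succinctness. -/
theorem not_idealSuccinct_of_transversal {𝒞 : Set (MvPolynomial σ F)} {G : M → MvPolynomial τ F}
    {E : ι → M} {H : τ → MvPolynomial κ F} {ν : ι → κ} (hH : ∀ i, bind₁ H (G (E i)) = X (ν i))
    (hν : Function.Injective ν) {D₀ : MvPolynomial ι F} (hD₀ : D₀ ≠ 0)
    (hvan : ∀ g ∈ 𝒞, eval (fun i => coeff ((E i : M) : σ →₀ ℕ) g) D₀ = 0) :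
    ¬ IsIdealSuccinctGenerator M 𝒞 G := by
  intro hsucc
  refine bind₁_rename_ne_zero_of_transversal hH hν hD₀ (hsucc (rename E D₀) fun g hg => ?_)
  rw [eval_rename]
  exact hvan g hg

end Transversal

/-- **Dimension edge, abstract form.** An ideal-succinct generator for `SmallCircuits ℂ n b` has no
transversal of size `|ι|` with `2^|ι| > (|ι|·2n+1)^(9376 (n+4)^(5b+21))`. -/
theorem two_pow_le_of_transversal {n b : ℕ} (hn : 1 ≤ n) {τ κ ι : Type*} [Fintype ι]
    {G : degLEMonomials n → MvPolynomial τ ℂ}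
    (hsucc : IsIdealSuccinctGenerator (degLEMonomials n) (SmallCircuits ℂ n b) G)
    {E : ι → degLEMonomials n} {H : τ → MvPolynomial κ ℂ} {ν : ι → κ}
    (hH : ∀ i, bind₁ H (G (E i)) = X (ν i)) (hν : Function.Injective ν) :
    2 ^ Fintype.card ι ≤ (Fintype.card ι * (2 * n) + 1) ^ (9376 * (n + 4) ^ (5 * b + 21)) := by
  by_contra hlt
  obtain ⟨D₀, hD0, -, hvan⟩ := exists_equation_on b n hn E (not_le.mp hlt)
  exact not_idealSuccinct_of_transversal hH hν hD0 hvan hsucc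


end KRSTEdge

end Summit.ValiantsHypothesis.ValiantsHypothesis.Theorems.BarrierLever.SuccinctHittingSetsForVP

end
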